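import Literature.Topology.FourManifolds.TwistCoords
import Mathlib.Analysis.SpecialFunctions.Trigonometric.Deriv
import HarnessLib

/-!
# Polar graphs under the angular twist

Topic `Literature/Topology/FourManifolds`; fact seat `provefact-IsStrictHandleSlide.isSurgery`
(R. C. Kirby, *The Topology of 4-Manifolds*, LNM 1374 (1989), Ch. I §4; remaining content: the
named fact (S) `Literature.Topology.FourManifolds.FramedLink.IsStrictHandleSlide.slideModel`).
In the slice picture of the pillbox sweep the finger of the first attaching circle is a **polar
graph** `r = ρ(θ)`. Under the angular twist (`TwistCoords.lean`) the point `(ρ θ, θ)` goes to polar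
coordinates `(ρ θ, α θ)`, `α θ = twistAngle c (ρ θ) θ`, with second Cartesian coordinate
`Y θ = ρ θ · sin (α θ)`. This file differentiates `α` and `Y` along the polar graph and gives the
**sign criterion** making `Y` strictly increasing (so that the twisted finger is a graph over the
second coordinate, as `exists_planarSweep` wants): below the tip line (`cos α ≥ 0`) every term of
`Y' = ρ' sin α (1 + c ρ cos α) + ρ cos α ∂α/∂θ` is nonnegative. Also: the twist angle is at most
`π/2` on the quarter `r ≤ r_T`, `0 ≤ θ ≤ θ_T` when the tip `(r_T, θ_T)` is twisted to the vertical.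
Proved here (no definitions, no named facts):

* `hasDerivAt_twistAngle_polar`, `hasDerivAt_polarY`, `twistAngle_pos`, `twistAngle_lt_pi`,
  `twistAngle_le_pi_div_two_of_le`, `cos_twistAngle_nonneg_of_le`, `deriv_polarY_pos`,
  `contDiffOn_polarY`, `contDiffOn_polarX`.

## References

* R. C. Kirby, *The Topology of 4-Manifolds*, LNM 1374, Springer (1989), Ch. I §4. [Kirby1989]
* M. W. Hirsch, *Differential Topology* (1976), Ch. 8 §1. [HirschDT1976]
-/

open scoped Topology Real ContDiff
open Set Real Filter

noncomputable section

namespace Literature.Topology.FourManifolds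

variable {c : ℝ} {ρ : ℝ → ℝ} {θ : ℝ}

/-- **The twist angle along a polar graph**: for `θ ∈ (-π, π)` and `ρ` differentiable at `θ`,
`d/dθ twistAngle c (ρ θ) θ = c sin α · ρ' θ + E / (cos² (θ/2) + E² sin² (θ/2))`, `E = e^{c ρ θ}`.
[folklore] -/
theorem hasDerivAt_twistAngle_polar (c : ℝ) {ρ : ℝ → ℝ} {ρ' θ : ℝ} (hρ : HasDerivAt ρ ρ' θ) (hθ : θ ∈ Ioo (-π) π) :
    HasDerivAt (fun θ ↦ twistAngle c (ρ θ) θ)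
      (c * sin (twistAngle c (ρ θ) θ) * ρ' +
        exp (c * ρ θ) / (cos (θ / 2) ^ 2 + exp (c * ρ θ) ^ 2 * sin (θ / 2) ^ 2)) θ := by
  have hc : 0 < cos (θ / 2) := cos_pos_of_mem_Ioo ⟨by linarith [hθ.1], by linarith [hθ.2]⟩
  have hEp : 0 < exp (c * ρ θ) := exp_pos _
  have hexp : HasDerivAt (fun θ ↦ exp (c * ρ θ)) (exp (c * ρ θ) * (c * ρ')) θ := (hρ.const_mul c).exp
  have hθ' : HasDerivAt (fun θ : ℝ ↦ θ / 2) (1 / 2) θ := by simpa using (hasDerivAt_id θ).div_const 2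
  have htan := (hasDerivAt_tan hc.ne').comp θ hθ'
  have hprod := hexp.mul htan
  have ha := ((hasDerivAt_arctan (exp (c * ρ θ) * tan (θ / 2))).comp θ hprod).const_mul 2
  refine (ha.congr_of_eventuallyEq (Eventually.of_forall fun x ↦ rfl)).congr_deriv ?_
  simp only [Function.comp_def]
  rw [sin_twistAngle_eq, tan_eq_sin_div_cos]
  have hc2 : cos (θ / 2) ≠ 0 := hc.ne'
  have hden : cos (θ / 2) ^ 2 + exp (c * ρ θ) ^ 2 * sin (θ / 2) ^ 2 ≠ 0 := by positivity
  field_simp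

/-- **The second twisted coordinate along a polar graph**, `Y θ = ρ θ · sin α θ`:
`Y' = ρ' sin α + ρ cos α · α'`. [folklore] -/
theorem hasDerivAt_polarY (c : ℝ) {ρ : ℝ → ℝ} {ρ' θ : ℝ} (hρ : HasDerivAt ρ ρ' θ) (hθ : θ ∈ Ioo (-π) π) :
    HasDerivAt (fun θ ↦ ρ θ * sin (twistAngle c (ρ θ) θ))
      (ρ' * sin (twistAngle c (ρ θ) θ) +
        ρ θ * (cos (twistAngle c (ρ θ) θ) *
          (c * sin (twistAngle c (ρ θ) θ) * ρ' +
            exp (c * ρ θ) / (cos (θ / 2) ^ 2 + exp (c * ρ θ) ^ 2 * sin (θ / 2) ^ 2)))) θ := by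
  have hα := hasDerivAt_twistAngle_polar c hρ hθ
  exact hρ.mul hα.sin

/-- **The first twisted coordinate along a polar graph**, `X θ = ρ θ · cos α θ`. [folklore] -/
theorem hasDerivAt_polarX (c : ℝ) {ρ : ℝ → ℝ} {ρ' θ : ℝ} (hρ : HasDerivAt ρ ρ' θ) (hθ : θ ∈ Ioo (-π) π) :
    HasDerivAt (fun θ ↦ ρ θ * cos (twistAngle c (ρ θ) θ))
      (ρ' * cos (twistAngle c (ρ θ) θ) +
        ρ θ * (-sin (twistAngle c (ρ θ) θ) *
          (c * sin (twistAngle c (ρ θ) θ) * ρ' +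
            exp (c * ρ θ) / (cos (θ / 2) ^ 2 + exp (c * ρ θ) ^ 2 * sin (θ / 2) ^ 2)))) θ := by
  have hα := hasDerivAt_twistAngle_polar c hρ hθ
  exact hρ.mul hα.cos

/-- The twist angle is positive for `θ ∈ (0, π)`. [folklore] -/
theorem twistAngle_pos (c r : ℝ) {θ : ℝ} (hθ : θ ∈ Ioo 0 π) : 0 < twistAngle c r θ := by
  unfold twistAngle
  have ht : 0 < tan (θ / 2) := tan_pos_of_pos_of_lt_pi_div_two (by linarith [hθ.1]) (by linarith [hθ.2])
  have := arctan_strictMono (mul_pos (exp_pos (c * r)) ht)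
  rw [arctan_zero] at this
  linarith

/-- The twist angle is `< π`. [folklore] -/
theorem twistAngle_lt_pi (c r θ : ℝ) : twistAngle c r θ < π := (twistAngle_mem_Ioo c r θ).2

/-- **Below the tip line the twist angle is at most `π/2`**: if `e^{c r_T} tan (θ_T/2) = 1`
(the tip is twisted to the vertical), `c ≥ 0`, `r ≤ r_T` and `0 ≤ θ ≤ θ_T < π`, then
`twistAngle c r θ ≤ π/2`. [folklore] -/
theorem twistAngle_le_pi_div_two_of_le {c r rT θ θT : ℝ} (hc : 0 ≤ c) (hr : r ≤ rT) (hθ0 : 0 ≤ θ) (hθ : θ ≤ θT)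
    (hθT : θT < π) (htip : exp (c * rT) * tan (θT / 2) = 1) : twistAngle c r θ ≤ π / 2 := by
  unfold twistAngle
  have ht0 : 0 ≤ tan (θ / 2) := tan_nonneg_of_nonneg_of_le_pi_div_two (by linarith) (by linarith)
  have ht : tan (θ / 2) ≤ tan (θT / 2) := by
    rcases hθ.eq_or_lt with h | h
    · rw [h]
    · exact (strictMonoOn_tan ⟨by linarith [pi_pos], by linarith⟩ ⟨by linarith [pi_pos], by linarith⟩ (by linarith)).le
  have he : exp (c * r) ≤ exp (c * rT) := exp_le_exp.2 (mul_le_mul_of_nonneg_left hr hc)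
  have hprod : exp (c * r) * tan (θ / 2) ≤ 1 := by
    calc exp (c * r) * tan (θ / 2) ≤ exp (c * rT) * tan (θT / 2) :=
          mul_le_mul he ht ht0 (exp_pos _).le
      _ = 1 := htip
  have := arctan_le_arctan_iff.2 hprod |>.trans_eq arctan_one
  · linarith
  where arctan_le_arctan_iff : ∀ {x y : ℝ}, arctan x ≤ arctan y ↔ x ≤ y := arctan_strictMono.le_iff_le

/-- Hence `cos α ≥ 0` below the tip line (for `θ ≥ 0`). [folklore] -/
theorem cos_twistAngle_nonneg_of_le {c r rT θ θT : ℝ} (hc : 0 ≤ c) (hr : r ≤ rT) (hθ0 : 0 ≤ θ) (hθ : θ ≤ θT)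
    (hθT : θT < π) (htip : exp (c * rT) * tan (θT / 2) = 1) : 0 ≤ cos (twistAngle c r θ) := by
  have h1 := twistAngle_le_pi_div_two_of_le hc hr hθ0 hθ hθT htip
  have h2 : 0 ≤ twistAngle c r θ := by
    rcases hθ0.eq_or_lt with h | h
    · rw [← h, twistAngle_zero]
    · exact (twistAngle_pos c r ⟨h, by linarith⟩).le
  exact cos_nonneg_of_mem_Icc ⟨by linarith [pi_pos], h1⟩

/-- **Sign criterion**: if along the polar graph `ρ' sin α ≥ 0`, `cos α ≥ 0`, `ρ > 0`, `c ≥ 0`, and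
either `cos α > 0` or `ρ' sin α > 0`, then `Y' > 0`. [folklore] -/
theorem deriv_polarY_pos (c : ℝ) {ρ : ℝ → ℝ} {ρ' θ : ℝ} (hρ : HasDerivAt ρ ρ' θ) (hθ : θ ∈ Ioo (-π) π)
    (hc : 0 ≤ c) (hpos : 0 < ρ θ) (h1 : 0 ≤ ρ' * sin (twistAngle c (ρ θ) θ))
    (h2 : 0 ≤ cos (twistAngle c (ρ θ) θ))
    (h3 : 0 < cos (twistAngle c (ρ θ) θ) ∨ 0 < ρ' * sin (twistAngle c (ρ θ) θ)) :
    0 < deriv (fun θ ↦ ρ θ * sin (twistAngle c (ρ θ) θ)) θ := by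
  rw [(hasDerivAt_polarY c hρ hθ).deriv]
  set α := twistAngle c (ρ θ) θ
  have hcth : 0 < cos (θ / 2) := cos_pos_of_mem_Ioo ⟨by linarith [hθ.1], by linarith [hθ.2]⟩
  have hE : 0 < exp (c * ρ θ) := exp_pos _
  have hq : 0 < exp (c * ρ θ) / (cos (θ / 2) ^ 2 + exp (c * ρ θ) ^ 2 * sin (θ / 2) ^ 2) := by positivity
  set q := exp (c * ρ θ) / (cos (θ / 2) ^ 2 + exp (c * ρ θ) ^ 2 * sin (θ / 2) ^ 2)
  -- `Y' = ρ' sin α + ρ cos α c (ρ' sin α) + ρ cos α q`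
  have hA : 0 ≤ ρ θ * cos α * c * (ρ' * sin α) := by
    have := mul_nonneg (mul_nonneg (mul_nonneg hpos.le h2) hc) h1; linarith
  have hB : 0 ≤ ρ θ * cos α * q := mul_nonneg (mul_nonneg hpos.le h2) hq.le
  rcases h3 with h | h
  · have hB' : 0 < ρ θ * cos α * q := mul_pos (mul_pos hpos h) hq
    nlinarith
  · nlinarith

/-- `Y` is `C^∞` on an open interval inside `(-π, π)` where `ρ` is. [folklore] -/
theorem contDiffOn_polarY (c : ℝ) {ρ : ℝ → ℝ} {u v : ℝ} (hρ : ContDiffOn ℝ ∞ ρ (Ioo u v))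
    (huv : Ioo u v ⊆ Ioo (-π) π) :
    ContDiffOn ℝ ∞ (fun θ ↦ ρ θ * sin (twistAngle c (ρ θ) θ)) (Ioo u v) := by
  have hmap : MapsTo (fun θ : ℝ ↦ (ρ θ, θ)) (Ioo u v) (univ ×ˢ Ioo (-π) π) :=
    fun θ hθ ↦ ⟨mem_univ _, huv hθ⟩
  have hg : ContDiffOn ℝ ∞ (fun θ : ℝ ↦ (ρ θ, θ)) (Ioo u v) := hρ.prodMk contDiffOn_id
  have h1 : ContDiffOn ℝ ∞ ((fun p : ℝ × ℝ ↦ twistAngle c p.1 p.2) ∘ (fun θ : ℝ ↦ (ρ θ, θ))) (Ioo u v) :=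
    (contDiffOn_twistAngle c).comp hg hmap
  exact (hρ.mul h1.sin).congr fun θ _ ↦ rfl

/-- `X` is `C^∞` on an open interval inside `(-π, π)` where `ρ` is. [folklore] -/
theorem contDiffOn_polarX (c : ℝ) {ρ : ℝ → ℝ} {u v : ℝ} (hρ : ContDiffOn ℝ ∞ ρ (Ioo u v))
    (huv : Ioo u v ⊆ Ioo (-π) π) :
    ContDiffOn ℝ ∞ (fun θ ↦ ρ θ * cos (twistAngle c (ρ θ) θ)) (Ioo u v) := by
  have hmap : MapsTo (fun θ : ℝ ↦ (ρ θ, θ)) (Ioo u v) (univ ×ˢ Ioo (-π) π) :=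
    fun θ hθ ↦ ⟨mem_univ _, huv hθ⟩
  have hg : ContDiffOn ℝ ∞ (fun θ : ℝ ↦ (ρ θ, θ)) (Ioo u v) := hρ.prodMk contDiffOn_id
  have h1 : ContDiffOn ℝ ∞ ((fun p : ℝ × ℝ ↦ twistAngle c p.1 p.2) ∘ (fun θ : ℝ ↦ (ρ θ, θ))) (Ioo u v) :=
    (contDiffOn_twistAngle c).comp hg hmap
  exact (hρ.mul h1.cos).congr fun θ _ ↦ rfl

/-- **Norm identity**: the twisted point has the same radius, `X² + Y² = ρ²`. [folklore] -/
theorem polarX_sq_add_polarY_sq (c : ℝ) (ρ : ℝ → ℝ) (θ : ℝ) :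
    (ρ θ * cos (twistAngle c (ρ θ) θ)) ^ 2 + (ρ θ * sin (twistAngle c (ρ θ) θ)) ^ 2 = ρ θ ^ 2 := by
  have := cos_sq_add_sin_sq (twistAngle c (ρ θ) θ)
  nlinarith [this]

end Literature.Topology.FourManifolds
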